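import Mathlib
import Summits.Ventures.PercRepro2.Tail2DBlockCalc
import Summits.Ventures.PercRepro2.Tail2DHarrisSP
import Summits.Ventures.PercRepro2.Tail2DFlowOneBlocks

/-!
# The parallel step of (SD) at `(0,1)` with a flow-one factor
(seat mine-b, cell pub-perc-repro2; conjectures/MINE-B.md §43)

For `Z = Y ∥ X` with `X` flow-one (`r + b ≤ 1`, with a red crossing) and `Y` ANY SP term, the tails at the
blue-axis positions are explicit: `E(0,1) = E_Y(0,1) × row ⊔ all_Y × B` and `E(0,2) = E_Y(0,2) × row ⊔ E_Y(0,1) × B`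
(`row = {b = 0} = R ⊔ C` of `X`).  The member `(0,1)` of (SD) on `Z` follows from three block dominations —
a **three-part coupling** in the image of the one-edge step `parFree_core`, with the row of `X` in the role of the
red edge: `E_Y(0,1) × row → E_Y(0,2) × row` ((SD) of `Y` at `(0,1)`, mass `m·T₂/|E'|`), the EXCESS of the row part
`E_Y(0,1) × row → E_Y(0,1) × B` (identity on `Y`, `row ≼ B` on `X`, mass `m·(T₁/|E| − T₂/|E'|)`), and
`all_Y × B → E_Y(0,1) × B` (Harris on `Y`).  The excess is non-negative exactly when the blue axis of `Y` is
log-concave at `1`: `T₀·T₂ ≤ T₁²` (the lane's `TailLC Y 0 1`).  The hypotheses hold on every parallel composition of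
flow-one networks (`sdomZ_flowOne_par`, `tailLC_flowOne_par`), which is how `Tail2DFlowOneThree.lean` uses the step.
-/

namespace Summit.Ventures.PercRepro2.Tail2D

open V2Closure Finset

section Step

variable (Y X : V2Closure.SP)

/-- membership in a tail set, by the labels -/
theorem mem_tailSet_iff (s : V2Closure.SP) (a c : ℕ) (x : s.Conf) :
    x ∈ tailSet s a c ↔ a ≤ s.rLab x ∧ c ≤ s.bLab x := by
  simp [tailSet]

/-- the blue tails `{b ≥ c}` are upper sets (local copy) -/
theorem tailSet_blue_upper (s : V2Closure.SP) (c : ℕ) :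
    ∀ x y : s.Conf, x ≤ y → x ∈ tailSet s 0 c → y ∈ tailSet s 0 c := by
  intro x y hxy hx
  rw [mem_tailSet_iff] at hx ⊢
  exact ⟨Nat.zero_le _, le_trans hx.2 (bLab_monotone s hxy)⟩

/-- the tail `E(0,0)` is everything: `T(0,0) = #Conf` -/
theorem tailCount_zero_zero (s : V2Closure.SP) : tailCount s 0 0 = Fintype.card s.Conf := by
  rw [tailCount_eq_card, ← Finset.card_univ]
  congr 1
  ext x; simp [tailSet]

/-- `E(0,1)` of `Y ∥ X` for flow-one `X`: `E_Y(0,1) × row ⊔ all × B` -/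
theorem tailSet_par_01_flowOne (hX : FlowOne X) :
    tailSet (V2Closure.SP.par Y X) 0 1
      = ((tailSet Y 0 1 ×ˢ rowSet X 0 : Finset (Y.Conf × X.Conf))
          ∪ ((Finset.univ : Finset Y.Conf) ×ˢ bSet X : Finset (Y.Conf × X.Conf))) := by
  apply Finset.ext; intro p
  rw [mem_tailSet_par']
  refine Iff.trans ?_ Finset.mem_union.symm
  refine Iff.trans ?_ (or_congr Finset.mem_product Finset.mem_product).symm
  rw [mem_tailSet_iff, mem_rowSet0, mem_bSet]
  have := hX p.2
  simp only [Finset.mem_univ, true_and]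
  omega

/-- `E(0,2)` of `Y ∥ X` for flow-one `X`: `E_Y(0,2) × row ⊔ E_Y(0,1) × B` -/
theorem tailSet_par_02_flowOne (hX : FlowOne X) :
    tailSet (V2Closure.SP.par Y X) 0 2
      = ((tailSet Y 0 2 ×ˢ rowSet X 0 : Finset (Y.Conf × X.Conf))
          ∪ (tailSet Y 0 1 ×ˢ bSet X : Finset (Y.Conf × X.Conf))) := by
  apply Finset.ext; intro p
  rw [mem_tailSet_par']
  refine Iff.trans ?_ Finset.mem_union.symm
  refine Iff.trans ?_ (or_congr Finset.mem_product Finset.mem_product).symm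
  rw [mem_tailSet_iff, mem_tailSet_iff, mem_rowSet0, mem_bSet]
  have := hX p.2
  omega

/-- `#E(0,1) = T₁·(n − a) + n_Y·a` -/
theorem tailCount_par_01_flowOne (hX : FlowOne X) :
    tailCount (V2Closure.SP.par Y X) 0 1
      = tailCount Y 0 1 * (Fintype.card X.Conf - (rSet X).card) + Fintype.card Y.Conf * (rSet X).card := by
  rw [tailCount_eq_card, tailSet_par_01_flowOne Y X hX]
  show ((tailSet Y 0 1 ×ˢ rowSet X 0 : Finset (Y.Conf × X.Conf))
      ∪ ((Finset.univ : Finset Y.Conf) ×ˢ bSet X : Finset (Y.Conf × X.Conf))).card = _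
  rw [Finset.card_union_of_disjoint, Finset.card_product, Finset.card_product, card_rowSet0, card_bSet_eq,
    Finset.card_univ, tailCount_eq_card]
  rw [Finset.disjoint_left]
  intro p h1 h2
  rw [Finset.mem_product, mem_rowSet0] at h1
  rw [Finset.mem_product, mem_bSet] at h2
  omega

/-- `#E(0,2) = T₂·(n − a) + T₁·a` -/
theorem tailCount_par_02_flowOne (hX : FlowOne X) :
    tailCount (V2Closure.SP.par Y X) 0 2
      = tailCount Y 0 2 * (Fintype.card X.Conf - (rSet X).card) + tailCount Y 0 1 * (rSet X).card := by
  rw [tailCount_eq_card, tailSet_par_02_flowOne Y X hX]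
  show ((tailSet Y 0 2 ×ˢ rowSet X 0 : Finset (Y.Conf × X.Conf))
      ∪ (tailSet Y 0 1 ×ˢ bSet X : Finset (Y.Conf × X.Conf))).card = _
  rw [Finset.card_union_of_disjoint, Finset.card_product, Finset.card_product, card_rowSet0, card_bSet_eq,
    tailCount_eq_card, tailCount_eq_card]
  rw [Finset.disjoint_left]
  intro p h1 h2
  rw [Finset.mem_product, mem_rowSet0] at h1
  rw [Finset.mem_product, mem_bSet] at h2
  omega

/-- the blue tails are nested: `T(0,c+1) ≤ T(0,c)` -/
theorem tailCount_blue_mono (s : V2Closure.SP) (c : ℕ) : tailCount s 0 (c + 1) ≤ tailCount s 0 c := by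
  rw [tailCount_eq_card, tailCount_eq_card]
  apply Finset.card_le_card
  intro x hx
  rw [mem_tailSet_iff] at hx ⊢
  omega

/-- **the `(0,1)` step with a flow-one factor**: from (SD) of `Y` at `(0,1)`, the log-concavity `T₀ T₂ ≤ T₁²` of
the blue axis of `Y` and `T₁ > 0`, (SD) of `Y ∥ X` at `(0,1)` for every flow-one `X` with a red crossing -/
theorem sdomZ_par_flowOne_01 (hX : FlowOne X) (ha : 0 < (rSet X).card) (hY : SDomZ Y 0 1)
    (hLC : tailCount Y 0 0 * tailCount Y 0 2 ≤ tailCount Y 0 1 * tailCount Y 0 1)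
    (hT1 : 0 < tailCount Y 0 1) : SDomZ (V2Closure.SP.par Y X) 0 1 := by
  rw [sdomZ_iff_blockDom] at hY ⊢
  have e1 : ((0 : ℤ)).toNat = 0 := rfl
  have e2 : ((1 : ℤ)).toNat = 1 := rfl
  have e3 : ((0 : ℤ) - 1).toNat = 0 := rfl
  have e4 : ((1 : ℤ) + 1).toNat = 2 := rfl
  rw [e1, e2, e3, e4] at hY ⊢
  obtain ⟨hB, -, hRow, hn, -, hBne, -, hRowne⟩ := counts X hX ha
  have hLe := card_rSet_le X
  rw [tailCount_zero_zero] at hLC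
  have hE := tailCount_par_01_flowOne Y X hX
  have hE' := tailCount_par_02_flowOne Y X hX
  have hT10 : tailCount Y 0 1 ≤ Fintype.card Y.Conf := by
    rw [← tailCount_zero_zero]; exact tailCount_blue_mono Y 0
  -- rational facts
  have hT1q : (0 : ℚ) < tailCount Y 0 1 := by exact_mod_cast hT1
  have hT0q : (0 : ℚ) < Fintype.card Y.Conf := by exact_mod_cast lt_of_lt_of_le hT1 hT10
  have haq : (0 : ℚ) < (rSet X).card := by exact_mod_cast ha
  have hnaq : (0 : ℚ) < ((Fintype.card X.Conf - (rSet X).card : ℕ) : ℚ) := by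
    exact_mod_cast Nat.sub_pos_of_lt hn
  have hT2q : (0 : ℚ) ≤ tailCount Y 0 2 := by positivity
  have hEq : (tailCount (V2Closure.SP.par Y X) 0 1 : ℚ)
      = tailCount Y 0 1 * ((Fintype.card X.Conf - (rSet X).card : ℕ) : ℚ)
        + Fintype.card Y.Conf * (rSet X).card := by
    rw [hE]; push_cast; ring
  have hE'q : (tailCount (V2Closure.SP.par Y X) 0 2 : ℚ)
      = tailCount Y 0 2 * ((Fintype.card X.Conf - (rSet X).card : ℕ) : ℚ) + tailCount Y 0 1 * (rSet X).card := by
    rw [hE']; push_cast; ring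
  have hEpos : (0 : ℚ) < tailCount (V2Closure.SP.par Y X) 0 1 := by rw [hEq]; positivity
  have hE'pos : (0 : ℚ) < tailCount (V2Closure.SP.par Y X) 0 2 := by rw [hE'q]; positivity
  have hE0 : (tailCount (V2Closure.SP.par Y X) 0 1 : ℚ) ≠ 0 := ne_of_gt hEpos
  have hE'0 : (tailCount (V2Closure.SP.par Y X) 0 2 : ℚ) ≠ 0 := ne_of_gt hE'pos
  have hT10' : (tailCount Y 0 1 : ℚ) ≠ 0 := ne_of_gt hT1q
  have hT00' : (Fintype.card Y.Conf : ℚ) ≠ 0 := ne_of_gt hT0q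
  have ha0 : ((rSet X).card : ℚ) ≠ 0 := ne_of_gt haq
  have hna0 : ((Fintype.card X.Conf - (rSet X).card : ℕ) : ℚ) ≠ 0 := ne_of_gt hnaq
  -- the excess weight is non-negative by the log-concavity of the blue axis
  obtain ⟨w2, hw2, hw2nn⟩ : ∃ w2 : ℚ,
      w2 = ((Fintype.card X.Conf - (rSet X).card : ℕ) : ℚ)
        * ((tailCount Y 0 1 : ℚ) / tailCount (V2Closure.SP.par Y X) 0 1
          - (tailCount Y 0 2 : ℚ) / tailCount (V2Closure.SP.par Y X) 0 2) ∧ 0 ≤ w2 := by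
    refine ⟨_, rfl, ?_⟩
    refine mul_nonneg hnaq.le ?_
    rw [sub_nonneg, div_le_div_iff₀ hE'pos hEpos, hEq, hE'q]
    have hLCq : (Fintype.card Y.Conf : ℚ) * tailCount Y 0 2 ≤ tailCount Y 0 1 * tailCount Y 0 1 := by
      exact_mod_cast hLC
    nlinarith
  refine blockDom_par_of_certificate Y X
      ![tailSet Y 0 1, tailSet Y 0 1, Finset.univ] ![tailSet Y 0 2, tailSet Y 0 1, tailSet Y 0 1]
      ![rowSet X 0, rowSet X 0, bSet X] ![rowSet X 0, bSet X, bSet X]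
      ![((Fintype.card X.Conf - (rSet X).card : ℕ) : ℚ)
          * ((tailCount Y 0 2 : ℚ) / tailCount (V2Closure.SP.par Y X) 0 2),
        w2,
        ((rSet X).card * Fintype.card Y.Conf : ℚ) / tailCount (V2Closure.SP.par Y X) 0 1]
      ?_ ?_ ?_ ?_ _ _ ?_ ?_
  · intro k; fin_cases k
    · show (0 : ℚ) ≤ ((Fintype.card X.Conf - (rSet X).card : ℕ) : ℚ)
        * ((tailCount Y 0 2 : ℚ) / tailCount (V2Closure.SP.par Y X) 0 2)
      positivity
    · exact hw2nn
    · show (0 : ℚ) ≤ ((rSet X).card * Fintype.card Y.Conf : ℚ) / tailCount (V2Closure.SP.par Y X) 0 1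
      positivity
  · intro k; fin_cases k
    · exact hY
    · exact blockDom_refl Y _
    · exact blockDom_univ_upper Y _ (tailSet_blue_upper Y 1)
  · intro k; fin_cases k
    · exact blockDom_refl X _
    · exact dom_row_b X
    · exact blockDom_refl X _
  · intro k hk _
    rcases k with ⟨k, hk'⟩
    interval_cases k
    · refine Finset.nonempty_product.2 ⟨Finset.card_pos.1 ?_, hRowne⟩
      have hk0 : (0 : ℚ) < ((Fintype.card X.Conf - (rSet X).card : ℕ) : ℚ)
          * ((tailCount Y 0 2 : ℚ) / tailCount (V2Closure.SP.par Y X) 0 2) := hk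
      show 0 < (tailSet Y 0 2).card
      rw [← tailCount_eq_card]
      by_contra h0
      have h0' : tailCount Y 0 2 = 0 := by omega
      rw [h0'] at hk0
      simp at hk0
    · exact Finset.nonempty_product.2 ⟨Finset.card_pos.1 (by show 0 < (tailSet Y 0 1).card; rw [← tailCount_eq_card]; exact hT1), hBne⟩
    · exact Finset.nonempty_product.2 ⟨Finset.card_pos.1 (by show 0 < (tailSet Y 0 1).card; rw [← tailCount_eq_card]; exact hT1), hBne⟩
  · rintro ⟨y, x⟩
    simp only [Fin.sum_univ_succ, Fin.sum_univ_zero, Matrix.cons_val_zero, Matrix.cons_val_succ,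
      unifDens_par_prod, unifDens_par_tail, mem_tailSet_iff, mem_rowSet0, mem_bSet, Finset.mem_univ, true_and,
      Finset.card_univ, hRow, hB, ← tailCount_eq_card]
    -- the cases: `x ∈ R`, `x ∈ B`, `x ∈ C`
    rcases flowOne_cases X hX x with hx | hx | hx
    · by_cases h1 : 1 ≤ Y.bLab y
      · simp [hx.1, hx.2, h1]
        rw [hw2]; field_simp; ring
      · simp [hx.1, hx.2, h1]
    · simp [hx.1, hx.2]
      field_simp
    · by_cases h1 : 1 ≤ Y.bLab y
      · simp [hx.1, hx.2, h1]
        rw [hw2]; field_simp; ring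
      · simp [hx.1, hx.2, h1]
  · rintro ⟨y, x⟩
    simp only [Fin.sum_univ_succ, Fin.sum_univ_zero, Matrix.cons_val_zero, Matrix.cons_val_succ,
      unifDens_par_prod, unifDens_par_tail, mem_tailSet_iff, mem_rowSet0, mem_bSet, hRow, hB, ← tailCount_eq_card]
    rcases flowOne_cases X hX x with hx | hx | hx
    · by_cases h2 : 2 ≤ Y.bLab y
      · have hT2pos : (tailCount Y 0 2 : ℚ) ≠ 0 := by
          have : 0 < tailCount Y 0 2 := by
            rw [tailCount_eq_card]
            exact Finset.card_pos.2 ⟨y, by rw [mem_tailSet_iff]; exact ⟨Nat.zero_le _, h2⟩⟩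
          exact_mod_cast ne_of_gt this
        simp [hx.1, hx.2, h2]
        field_simp
      · simp [hx.1, hx.2, h2]
    · by_cases h1 : 1 ≤ Y.bLab y
      · simp [hx.1, hx.2, h1]
        rw [hw2, hEq, hE'q]; field_simp; ring
      · simp [hx.1, hx.2, h1]
    · by_cases h2 : 2 ≤ Y.bLab y
      · have hT2pos : (tailCount Y 0 2 : ℚ) ≠ 0 := by
          have : 0 < tailCount Y 0 2 := by
            rw [tailCount_eq_card]
            exact Finset.card_pos.2 ⟨y, by rw [mem_tailSet_iff]; exact ⟨Nat.zero_le _, h2⟩⟩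
          exact_mod_cast ne_of_gt this
        simp [hx.1, hx.2, h2]
        field_simp
      · simp [hx.1, hx.2, h2]

end Step

end Summit.Ventures.PercRepro2.Tail2D
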